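import Literature.Algebra.Homology.ExtOfAcyclicResolutionNaturality
import Mathlib.Algebra.Homology.DerivedCategory.Ext.Map
import HarnessLib

/-!
# Functoriality of `Extⁿ(X, M) ≅ Hⁿ(Ext⁰(X, I•))` under exact functors

Topic `Algebra/Homology`; namespace `Literature.Algebra.Homology.AcyclicResolution`.  Sequel of
`ExtOfAcyclicResolution` / `…Naturality`; pure homological algebra, no named fact, no `sorry`.

Let `F : C ⥤ D` be an EXACT additive functor between abelian categories (both with `HasExt` in the
same universe), `0 → M —η→ I•` an exact `Ext(X, –)`-acyclic augmented complex in `C` such that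
`F I•` is `Ext(F X, –)`-acyclic in `D`.  Then `F I•` is an exact augmented complex of `F M`
(`map_exactAt`, `map_exact_augmentation`) and the square

  `Extⁿ_C(X, M)      ≃+  Hⁿ(Ext⁰_C(X, I•))`
  `   | F                    | Hⁿ(F_*)`
  `Extⁿ_D(F X, F M)  ≃+  Hⁿ(Ext⁰_D(F X, F I•))`

commutes (`extAddEquivHomologySucc_map`, `extAddEquivHomologyZero_map`), where `F` on the left is
Mathlib's `Ext.mapExactFunctor F` and `F_*` the cochain map with components
`F.mapExtAddHom X (Iⁿ) 0` (`extComplexMapF`).  Steps: `F` commutes with cycles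
(`ShortComplex.mapCyclesIso`, packaged as `cyclesIsoF`), with the classes of the short exact sequences
`0 → Zⁿ → Iⁿ → Zⁿ⁺¹ → 0` (Mathlib `Ext.mapExactFunctor_extClass` + `extClass_naturality`), hence with
each dimension shift, with the bottom quotient, and with the concrete description of homology
(`homologyMap_concreteOf`, for an arbitrary cochain map of complexes of abelian groups).

Use (Route A of crux `stmt-BirchSwinnertonDyer-19295`, seat door-c4 gen 13): with `F` the restriction
`C_Γ ⥤ C_U` to an open subgroup (`DiscreteRepOpenSubgroup.resD`, exact; restricted standard complexes
acyclic by `DiscreteRepOpenSubgroupCoindRes`) this is the engine of the compatibility of the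
comparison `Extⁿ_{C_Γ}(k, M) ≅ Hⁿ_cont(Γ, M)` with restriction (Harari §4.3 (2), Definition 1.33;
Weibel §2.4 Exercise 2.4.3, Theorem 2.7.6).

## References
* C. A. Weibel, *An introduction to homological algebra*, CUP (1994), §2.4, Thm. 2.7.6. [Weibel1994]
-/

-- CITATION-FIX (2026-08-27, door-c4 g13; referee flag Q-g51-1): the header's "Harari Prop. 16.17" (which
-- is the cup-product/`Ext`-pairing compatibility, p. 272 of the held copy) replaced by the printed homes
-- of restriction (§1.5 Definition 1.33; profinite case §4.3 (2), p. 96).  Declarations unchanged.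

noncomputable section

universe w v v' u u'

namespace Literature.Algebra.Homology

namespace AcyclicResolution

open CategoryTheory CategoryTheory.Limits CategoryTheory.Abelian

/-! ## §1 Concrete homology maps for an arbitrary cochain map of complexes of abelian groups -/

section Concrete

variable {K K' : CochainComplex AddCommGrpCat.{w} ℕ} (ψ : K ⟶ K')

/-- The map induced on `ker dʲ` by a cochain map. [cite: Weibel1994, §2.4 (dimension shifting, Exercise 2.4.3)] -/
def kerMapOf (i j k : ℕ) :
    AddMonoidHom.ker (K.sc' i j k).g.hom →+ AddMonoidHom.ker (K'.sc' i j k).g.hom :=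
  ((((HomologicalComplex.shortComplexFunctor' _ _ i j k).map ψ).τ₂.hom).comp
      (AddMonoidHom.ker (K.sc' i j k).g.hom).subtype).codRestrict _ (fun y => by
    have hy : (K.sc' i j k).g.hom y.1 = 0 := y.2
    change (((HomologicalComplex.shortComplexFunctor' _ _ i j k).map ψ).τ₂ ≫ (K'.sc' i j k).g).hom
      y.1 = 0
    rw [((HomologicalComplex.shortComplexFunctor' _ _ i j k).map ψ).comm₂₃]
    change (((HomologicalComplex.shortComplexFunctor' _ _ i j k).map ψ).τ₃).hom
      ((K.sc' i j k).g.hom y.1) = 0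
    rw [hy, map_zero])

/-- Formula. [cite: Weibel1994, §2.4 (dimension shifting, Exercise 2.4.3)] -/
@[simp]
theorem kerMapOf_apply_val (i j k : ℕ) (y : AddMonoidHom.ker (K.sc' i j k).g.hom) :
    (kerMapOf ψ i j k y).1 = (ψ.f j).hom y.1 := rfl

/-- `kerMapOf` respects the images of `abToCycles`. [cite: Weibel1994, §2.4 (dimension shifting, Exercise 2.4.3)] -/
theorem range_abToCycles_le_comap_kerMapOf (i j k : ℕ) :
    (K.sc' i j k).abToCycles.range ≤ ((K'.sc' i j k).abToCycles.range).comap (kerMapOf ψ i j k) := by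
  rintro _ ⟨x, rfl⟩
  refine ⟨(((HomologicalComplex.shortComplexFunctor' _ _ i j k).map ψ).τ₁).hom x, Subtype.ext ?_⟩
  rw [ShortComplex.abToCycles_apply_coe, kerMapOf_apply_val, ShortComplex.abToCycles_apply_coe]
  change ((((HomologicalComplex.shortComplexFunctor' _ _ i j k).map ψ).τ₁ ≫ (K'.sc' i j k).f).hom x
    : (K'.sc' i j k).X₂) = _
  rw [((HomologicalComplex.shortComplexFunctor' _ _ i j k).map ψ).comm₁₂]
  rfl

/-- The map on `ker dʲ ⧸ Im dⁱ`. [cite: Weibel1994, §2.4 (dimension shifting, Exercise 2.4.3)] -/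
def kerQuotMapOf (i j k : ℕ) :
    AddMonoidHom.ker (K.sc' i j k).g.hom ⧸ (K.sc' i j k).abToCycles.range →+
      AddMonoidHom.ker (K'.sc' i j k).g.hom ⧸ (K'.sc' i j k).abToCycles.range :=
  QuotientAddGroup.map _ _ (kerMapOf ψ i j k) (range_abToCycles_le_comap_kerMapOf ψ i j k)

/-- The `LeftHomologyMapData` on `abLeftHomologyData` induced by a cochain map.
[cite: Weibel1994, §2.4 (dimension shifting, Exercise 2.4.3)] -/
def abLeftHomologyMapDataOf (i j k : ℕ) :
    ShortComplex.LeftHomologyMapData ((HomologicalComplex.shortComplexFunctor' _ _ i j k).map ψ)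
      (K.sc' i j k).abLeftHomologyData (K'.sc' i j k).abLeftHomologyData where
  φK := AddCommGrpCat.ofHom (kerMapOf ψ i j k)
  φH := AddCommGrpCat.ofHom (kerQuotMapOf ψ i j k)
  commi := rfl
  commf' := by
    ext x
    apply Subtype.ext
    change (kerMapOf ψ i j k ((K.sc' i j k).abToCycles x)).1 =
      ((K'.sc' i j k).abToCycles ((((HomologicalComplex.shortComplexFunctor' _ _ i j k).map ψ).τ₁).hom
        x)).1
    rw [kerMapOf_apply_val, ShortComplex.abToCycles_apply_coe, ShortComplex.abToCycles_apply_coe]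
    change _ = ((((HomologicalComplex.shortComplexFunctor' _ _ i j k).map ψ).τ₁ ≫ (K'.sc' i j k).f).hom
      x : (K'.sc' i j k).X₂)
    rw [((HomologicalComplex.shortComplexFunctor' _ _ i j k).map ψ).comm₁₂]
    rfl
  commπ := rfl

/-- **The homology map of a cochain map of complexes of abelian groups, read through
`homologyIsoSc' ≪≫ abHomologyIso`, is `kerQuotMapOf`.** [cite: Weibel1994, §2.4 (dimension shifting, Exercise 2.4.3)] -/
theorem homologyMap_concreteOf (i j k : ℕ) (hi : (ComplexShape.up ℕ).prev j = i)
    (hk : (ComplexShape.up ℕ).next j = k) :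
    HomologicalComplex.homologyMap ψ j ≫ (K'.homologyIsoSc' i j k hi hk ≪≫ ShortComplex.abHomologyIso _).hom =
      (K.homologyIsoSc' i j k hi hk ≪≫ ShortComplex.abHomologyIso _).hom ≫
        AddCommGrpCat.ofHom (kerQuotMapOf ψ i j k) := by
  have h1 : HomologicalComplex.homologyMap ψ j ≫ (K'.homologyIsoSc' i j k hi hk).hom =
      (K.homologyIsoSc' i j k hi hk).hom ≫
        ShortComplex.homologyMap ((HomologicalComplex.shortComplexFunctor' _ _ i j k).map ψ) := by
    change ShortComplex.homologyMap ((HomologicalComplex.shortComplexFunctor _ _ j).map ψ) ≫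
        ShortComplex.homologyMap ((HomologicalComplex.natIsoSc' _ _ i j k hi hk).hom.app K') =
      ShortComplex.homologyMap ((HomologicalComplex.natIsoSc' _ _ i j k hi hk).hom.app K) ≫
        ShortComplex.homologyMap ((HomologicalComplex.shortComplexFunctor' _ _ i j k).map ψ)
    rw [← ShortComplex.homologyMap_comp, ← ShortComplex.homologyMap_comp,
      (HomologicalComplex.natIsoSc' _ _ i j k hi hk).hom.naturality]
  rw [Iso.trans_hom, Iso.trans_hom, ← Category.assoc, h1, Category.assoc, Category.assoc]
  congr 1
  exact (abLeftHomologyMapDataOf ψ i j k).homologyMap_comm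

end Concrete

/-! ## §2 An exact functor and the cycles of a complex -/

section Functor

variable {C : Type u} [Category.{v} C] [Abelian C] [HasExt.{w} C]
  {D : Type u'} [Category.{v'} D] [Abelian D] [HasExt.{w} D]
  (F : C ⥤ D) [F.Additive] [PreservesFiniteLimits F] [PreservesFiniteColimits F]
  (X : C) (I : CochainComplex C ℕ)

/-- `F I•`. [cite: Weibel1994, Theorem 2.7.6] -/
abbrev mapComplex : CochainComplex D ℕ := (F.mapHomologicalComplex (ComplexShape.up ℕ)).obj I

/-- **`F` commutes with cycles**: `F(Zʲ I) ≅ Zʲ(F I)` (Mathlib `ShortComplex.mapCyclesIso`).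
[cite: Weibel1994, Theorem 2.7.6] -/
def cyclesIsoF (j : ℕ) : F.obj (I.cycles j) ≅ (mapComplex F I).cycles j :=
  ((I.sc j).mapCyclesIso F).symm

omit [HasExt C] [HasExt D] in
/-- `κ ≫ ι_{Z(FI)} = F(ι_Z)`. [cite: Weibel1994, Theorem 2.7.6] -/
@[reassoc (attr := simp)]
theorem cyclesIsoF_hom_iCycles (j : ℕ) :
    (cyclesIsoF F I j).hom ≫ (mapComplex F I).iCycles j = F.map (I.iCycles j) :=
  (congrArg (fun t => (cyclesIsoF F I j).hom ≫ t) ((I.sc j).mapCyclesIso_hom_iCycles F).symm).trans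
    (Iso.inv_hom_id_assoc _ _)

omit [HasExt C] [HasExt D] in
/-- `F(toCycles) ≫ κ = toCycles`. [cite: Weibel1994, Theorem 2.7.6] -/
@[reassoc]
theorem map_toCycles_comp_cyclesIsoF_hom (n : ℕ) :
    F.map (I.toCycles n (n + 1)) ≫ (cyclesIsoF F I (n + 1)).hom =
      (mapComplex F I).toCycles n (n + 1) := by
  rw [← cancel_mono ((mapComplex F I).iCycles (n + 1)), Category.assoc, cyclesIsoF_hom_iCycles]
  -- both sides as morphisms `(F I)ⁿ ⟶ (F I)ⁿ⁺¹` (the objects `(F I)ⁿ = F (Iⁿ)` agree definitionally)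
  change F.map _ ≫ F.map _ = (mapComplex F I).toCycles n (n + 1) ≫ (mapComplex F I).iCycles (n + 1)
  rw [HomologicalComplex.toCycles_i]
  change F.map _ ≫ F.map _ = F.map (I.d n (n + 1))
  rw [← F.map_comp, HomologicalComplex.toCycles_i]

omit [HasExt C] [HasExt D] [PreservesFiniteLimits F] [PreservesFiniteColimits F] in
/-- `F ι ≫ F toCycles = 0`. [cite: Weibel1994, Theorem 2.7.6] -/
theorem map_iCycles_toCycles (n : ℕ) : F.map (I.iCycles n) ≫ F.map (I.toCycles n (n + 1)) = 0 := by
  rw [← F.map_comp, iCycles_toCycles, F.map_zero]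

/-- `F` applied to `0 → Zⁿ → Iⁿ → Zⁿ⁺¹ → 0`, as an explicit short complex (= `(cyclesSC I n).map F`).
[cite: Weibel1994, Theorem 2.7.6] -/
abbrev cyclesSCF (n : ℕ) : ShortComplex D :=
  ShortComplex.mk (F.map (I.iCycles n)) (F.map (I.toCycles n (n + 1))) (map_iCycles_toCycles F I n)

omit [HasExt C] [HasExt D] in
/-- It is short exact when `I` is exact at `n + 1`. [cite: Weibel1994, Theorem 2.7.6] -/
theorem cyclesSCF_shortExact (n : ℕ) (h : I.ExactAt (n + 1)) : (cyclesSCF F I n).ShortExact :=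
  (cyclesSC_shortExact I n h).map_of_exact F

/-- `F([S]) = [F S]` for the cycle sequences. [cite: Weibel1994, Theorem 2.7.6] -/
theorem mapExactFunctor_extClass_cyclesSC (n : ℕ) (hS : (cyclesSC I n).ShortExact)
    (h : I.ExactAt (n + 1)) :
    hS.extClass.mapExactFunctor F = (cyclesSCF_shortExact F I n h).extClass :=
  (Ext.mapExactFunctor_extClass F hS).trans rfl

/-- The morphism of short complexes `F(0 → Zⁿ → Iⁿ → Zⁿ⁺¹ → 0) ⟶ (0 → Zⁿ(FI) → FIⁿ → Zⁿ⁺¹(FI) → 0)`.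
[cite: Weibel1994, Theorem 2.7.6] -/
abbrev cyclesSCMapF (n : ℕ) : cyclesSCF F I n ⟶ cyclesSC (mapComplex F I) n where
  τ₁ := (cyclesIsoF F I n).hom
  τ₂ := 𝟙 _
  τ₃ := (cyclesIsoF F I (n + 1)).hom
  comm₁₂ := by
    change (cyclesIsoF F I n).hom ≫ (mapComplex F I).iCycles n = F.map (I.iCycles n) ≫ 𝟙 _
    rw [Category.comp_id, cyclesIsoF_hom_iCycles]
  comm₂₃ := by
    change 𝟙 _ ≫ (mapComplex F I).toCycles n (n + 1) =
      F.map (I.toCycles n (n + 1)) ≫ (cyclesIsoF F I (n + 1)).hom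
    rw [Category.id_comp, map_toCycles_comp_cyclesIsoF_hom]

omit [HasExt C] in
/-- `F([S]) ∘ κₙ = κₙ₊₁ ∘ [S_{FI}]`. [cite: Weibel1994, Theorem 2.7.6] -/
theorem extClass_cyclesSCF_comp (n : ℕ) (h : I.ExactAt (n + 1))
    (hS' : (cyclesSC (mapComplex F I) n).ShortExact) :
    (cyclesSCF_shortExact F I n h).extClass.comp (Ext.mk₀ (cyclesIsoF F I n).hom) (add_zero 1) =
      (Ext.mk₀ (cyclesIsoF F I (n + 1)).hom).comp hS'.extClass (zero_add 1) :=
  ShortComplex.ShortExact.extClass_naturality (cyclesSCF_shortExact F I n h) hS' (cyclesSCMapF F I n)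

omit [HasExt C] [HasExt D] in
/-- `F I` is exact in positive degrees if `I` is. [cite: Weibel1994, Theorem 2.7.6] -/
theorem map_exactAt (hI : ∀ n, I.ExactAt (n + 1)) (n : ℕ) : (mapComplex F I).ExactAt (n + 1) :=
  (hI n).map F

variable {M : C} (η : M ⟶ I.X 0) (hη : η ≫ I.d 0 1 = 0)

omit [HasExt C] [HasExt D] [PreservesFiniteLimits F] [PreservesFiniteColimits F] in
include hη in
/-- `F η ≫ d⁰ = 0`. [cite: Weibel1994, Theorem 2.7.6] -/
theorem map_hη : F.map η ≫ (mapComplex F I).d 0 1 = 0 := by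
  change F.map η ≫ F.map (I.d 0 1) = 0
  rw [← F.map_comp, hη, F.map_zero]

omit [HasExt C] [HasExt D] [PreservesFiniteLimits F] [PreservesFiniteColimits F] in
/-- `F η`, read as the augmentation `F M ⟶ (F I)⁰` of `F I•`, is a monomorphism when `F η : F M ⟶ F(I⁰)`
is one: the two targets `(F I)⁰` and `F(I⁰)` agree definitionally (by unfolding
`Functor.mapHomologicalComplex`), but not reducibly, so this repackaging is recorded as a local
instance for the statements below. [cite: Weibel1994, Theorem 2.7.6] -/
theorem mono_map_augmentation [Mono (F.map η)] :
    @Mono D _ (F.obj M) ((mapComplex F I).X 0) (F.map η) := ‹Mono (F.map η)›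

attribute [local instance] mono_map_augmentation

omit [HasExt C] [HasExt D] in
/-- `F M → F I⁰ → F I¹` is exact. [cite: Weibel1994, Theorem 2.7.6] -/
theorem map_exact_augmentation (hex : (ShortComplex.mk η (I.d 0 1) hη).Exact) :
    (ShortComplex.mk (F.map η) ((mapComplex F I).d 0 1) (map_hη F I η hη)).Exact :=
  hex.map F

omit [HasExt C] [HasExt D] in
/-- `F` on the cycle isomorphism `M ≅ Z⁰`: `F(iso) ≫ κ₀ = iso_{F I}`. [cite: Weibel1994, Theorem 2.7.6] -/
theorem map_isoCyclesZero_hom (hex : (ShortComplex.mk η (I.d 0 1) hη).Exact) [Mono η]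
    [Mono (F.map η)] :
    F.map (isoCyclesZero I η hη hex).hom ≫ (cyclesIsoF F I 0).hom =
      (isoCyclesZero (mapComplex F I) (F.map η) (map_hη F I η hη)
        (map_exact_augmentation F I η hη hex)).hom := by
  rw [← cancel_mono ((mapComplex F I).iCycles 0), Category.assoc, cyclesIsoF_hom_iCycles]
  -- re-read the left-hand side as a composite of morphisms between objects `F(_)`
  change F.map _ ≫ F.map _ = _
  rw [← F.map_comp, isoCyclesZero_hom_iCycles, isoCyclesZero_hom_iCycles]

/-! ## §3 `F` and the dimension shifts -/

/-- **`F` commutes with one dimension shift** (up to the cycle isomorphisms `κ`).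
[cite: Weibel1994, Theorem 2.7.6] -/
theorem shiftAddEquiv_map (n : ℕ) (hn : I.ExactAt (n + 1)) (hS : (cyclesSC I n).ShortExact)
    (hS' : (cyclesSC (mapComplex F I) n).ShortExact) {a b : ℕ} (h : a + 1 = b)
    (ha : ∀ e : Ext X (I.X n) a, e = 0) (hb : ∀ e : Ext X (I.X n) b, e = 0)
    (ha' : ∀ e : Ext (F.obj X) ((mapComplex F I).X n) a, e = 0)
    (hb' : ∀ e : Ext (F.obj X) ((mapComplex F I).X n) b, e = 0) (x : Ext X (I.cycles (n + 1)) a) :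
    ((shiftAddEquiv X hS h ha hb x).mapExactFunctor F).comp (Ext.mk₀ (cyclesIsoF F I n).hom)
        (add_zero b) =
      shiftAddEquiv (F.obj X) hS' h ha' hb'
        ((x.mapExactFunctor F).comp (Ext.mk₀ (cyclesIsoF F I (n + 1)).hom) (add_zero a)) := by
  rw [shiftAddEquiv_apply, shiftAddEquiv_apply, Ext.mapExactFunctor_comp,
    mapExactFunctor_extClass_cyclesSC F I n hS hn, Ext.comp_assoc_of_third_deg_zero,
    extClass_cyclesSCF_comp F I n hn hS', ← Ext.comp_assoc_of_second_deg_zero]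

/-- **`F` commutes with the iterated shift.** [cite: Weibel1994, Theorem 2.7.6] -/
theorem iterShift_map (hI : ∀ n, I.ExactAt (n + 1)) (hX : ∀ n q (e : Ext X (I.X n) (q + 1)), e = 0)
    (hX' : ∀ n q (e : Ext (F.obj X) ((mapComplex F I).X n) (q + 1)), e = 0) :
    ∀ (n : ℕ) {a b : ℕ} (h : a + 1 + n = b) (x : Ext X (I.cycles n) (a + 1)),
      ((iterShift I X hI hX n h x).mapExactFunctor F).comp (Ext.mk₀ (cyclesIsoF F I 0).hom)
          (add_zero b) =
        iterShift (mapComplex F I) (F.obj X) (map_exactAt F I hI) hX' n h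
          ((x.mapExactFunctor F).comp (Ext.mk₀ (cyclesIsoF F I n).hom) (add_zero _))
  | 0, a, b, h, x => by
    subst h
    rw [iterShift_zero_apply, iterShift_zero_apply]
  | n + 1, a, b, h, x => by
    rw [iterShift_succ_apply, iterShift_succ_apply, iterShift_map hI hX hX' n,
      shiftAddEquiv_map F X I n (hI n)]

/-- `F` and `iterShift⁻¹`. [cite: Weibel1994, Theorem 2.7.6] -/
theorem iterShift_symm_map (hI : ∀ n, I.ExactAt (n + 1))
    (hX : ∀ n q (e : Ext X (I.X n) (q + 1)), e = 0)
    (hX' : ∀ n q (e : Ext (F.obj X) ((mapComplex F I).X n) (q + 1)), e = 0) (n : ℕ) {a b : ℕ}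
    (h : a + 1 + n = b) (z : Ext X (I.cycles 0) b) :
    (iterShift (mapComplex F I) (F.obj X) (map_exactAt F I hI) hX' n h).symm
        ((z.mapExactFunctor F).comp (Ext.mk₀ (cyclesIsoF F I 0).hom) (add_zero b)) =
      (((iterShift I X hI hX n h).symm z).mapExactFunctor F).comp
        (Ext.mk₀ (cyclesIsoF F I n).hom) (add_zero _) := by
  apply (iterShift (mapComplex F I) (F.obj X) (map_exactAt F I hI) hX' n h).injective
  rw [AddEquiv.apply_symm_apply, ← iterShift_map F X I hI hX hX' n h, AddEquiv.apply_symm_apply]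

/-- `F` and the transport along `M ≅ Z⁰`. [cite: Weibel1994, Theorem 2.7.6] -/
theorem extAddEquivOfIso_isoCyclesZero_map (hex : (ShortComplex.mk η (I.d 0 1) hη).Exact) [Mono η]
    [Mono (F.map η)] (n : ℕ) (x : Ext X M n) :
    ((extAddEquivOfIso X (isoCyclesZero I η hη hex) n x).mapExactFunctor F).comp
        (Ext.mk₀ (cyclesIsoF F I 0).hom) (add_zero n) =
      extAddEquivOfIso (F.obj X) (isoCyclesZero (mapComplex F I) (F.map η) (map_hη F I η hη)
        (map_exact_augmentation F I η hη hex)) n (x.mapExactFunctor F) := by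
  rw [extAddEquivOfIso_apply, extAddEquivOfIso_apply, Ext.mapExactFunctor_comp,
    Ext.mapExactFunctor_mk₀, Ext.comp_assoc_of_second_deg_zero, Ext.mk₀_comp_mk₀,
    map_isoCyclesZero_hom]

/-- `F` and the bottom quotient: the class of `δ y` goes to the class of `F y ∘ κ`.
[cite: Weibel1994, Theorem 2.7.6] -/
theorem extOneQuotientAddEquiv_map (n : ℕ) (hn : I.ExactAt (n + 1)) (hS : (cyclesSC I n).ShortExact)
    (hS' : (cyclesSC (mapComplex F I) n).ShortExact) (h1 : ∀ e : Ext X (I.X n) 1, e = 0)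
    (h1' : ∀ e : Ext (F.obj X) ((mapComplex F I).X n) 1, e = 0) (x : Ext X (I.cycles n) 1) :
    QuotientAddGroup.map _ _
        (((Ext.mk₀ (cyclesIsoF F I (n + 1)).hom).postcomp (F.obj X) (add_zero 0)).comp
          (F.mapExtAddHom X (I.cycles (n + 1)) 0))
        (fun y hy => by
          obtain ⟨z, rfl⟩ := hy
          refine ⟨z.mapExactFunctor F, ?_⟩
          change (z.mapExactFunctor F).comp (Ext.mk₀ ((mapComplex F I).toCycles n (n + 1)))
              (add_zero 0) =
            ((z.comp (Ext.mk₀ (I.toCycles n (n + 1))) (add_zero 0)).mapExactFunctor F).comp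
              (Ext.mk₀ (cyclesIsoF F I (n + 1)).hom) (add_zero 0)
          rw [Ext.mapExactFunctor_comp, Ext.mapExactFunctor_mk₀, Ext.comp_assoc_of_second_deg_zero,
            Ext.mk₀_comp_mk₀, map_toCycles_comp_cyclesIsoF_hom])
        (extOneQuotientAddEquiv X hS h1 x) =
      extOneQuotientAddEquiv (F.obj X) hS' h1'
        ((x.mapExactFunctor F).comp (Ext.mk₀ (cyclesIsoF F I n).hom) (add_zero 1)) := by
  obtain ⟨y, rfl⟩ := extClass_postcomp_surjective X hS (zero_add 1) h1 x
  have e₁ : extOneQuotientAddEquiv X hS h1 (hS.extClass.postcomp X (zero_add 1) y) =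
      QuotientAddGroup.mk y :=
    (AddEquiv.apply_eq_iff_symm_apply _).2 (extOneQuotientAddEquiv_symm_mk X hS h1 y).symm
  have e₂ : ((hS.extClass.postcomp X (zero_add 1) y).mapExactFunctor F).comp
      (Ext.mk₀ (cyclesIsoF F I n).hom) (add_zero 1) =
      hS'.extClass.postcomp (F.obj X) (zero_add 1)
        ((y.mapExactFunctor F).comp (Ext.mk₀ (cyclesIsoF F I (n + 1)).hom) (add_zero 0)) := by
    change ((y.comp hS.extClass (zero_add 1)).mapExactFunctor F).comp _ _ =
      ((y.mapExactFunctor F).comp _ _).comp hS'.extClass (zero_add 1)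
    rw [Ext.mapExactFunctor_comp, mapExactFunctor_extClass_cyclesSC F I n hS hn,
      Ext.comp_assoc_of_third_deg_zero, extClass_cyclesSCF_comp F I n hn hS',
      ← Ext.comp_assoc_of_second_deg_zero]
  have e₃ : extOneQuotientAddEquiv (F.obj X) hS' h1'
      (hS'.extClass.postcomp (F.obj X) (zero_add 1)
        ((y.mapExactFunctor F).comp (Ext.mk₀ (cyclesIsoF F I (n + 1)).hom) (add_zero 0))) =
      QuotientAddGroup.mk ((y.mapExactFunctor F).comp (Ext.mk₀ (cyclesIsoF F I (n + 1)).hom)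
        (add_zero 0)) :=
    (AddEquiv.apply_eq_iff_symm_apply _).2 (extOneQuotientAddEquiv_symm_mk (F.obj X) hS' h1' _).symm
  rw [e₁, e₂, e₃]
  rfl

/-- `F` and `cyclesExtAddEquiv` (underlying elements). [cite: Weibel1994, Theorem 2.7.6] -/
theorem cyclesExtAddEquiv_map (i j k : ℕ) (hjk : (ComplexShape.up ℕ).next j = k)
    (x : Ext X (I.cycles j) 0) :
    (cyclesExtAddEquiv (F.obj X) (mapComplex F I) i j k hjk
        ((x.mapExactFunctor F).comp (Ext.mk₀ (cyclesIsoF F I j).hom) (add_zero 0))).1 =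
      (cyclesExtAddEquiv X I i j k hjk x).1.mapExactFunctor F := by
  rw [cyclesExtAddEquiv_apply_val, cyclesExtAddEquiv_apply_val, Ext.comp_assoc_of_second_deg_zero,
    Ext.mk₀_comp_mk₀, cyclesIsoF_hom_iCycles, Ext.mapExactFunctor_comp, Ext.mapExactFunctor_mk₀]
  -- the two sides now differ only by the definitional unfolding `(F I)ʲ = F (Iʲ)` of a target object
  rfl

end Functor

end AcyclicResolution

end Literature.Algebra.Homology
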